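import Literature.NumberTheory.LFunctions.WeilCriterionProofs
import Literature.NumberTheory.LFunctions.WeilArchimedeanPositivityProofs
import Literature.NumberTheory.LFunctions.WeilExplicitArchTermProofs
import Literature.NumberTheory.ConnesConsani2021.ArchimedeanDictionary
import Literature.NumberTheory.ConnesConsani2021.VanishingConditions
import Literature.Analysis.Complex.BoundedPowerSums
import HarnessLib

/-!
# Connes–Consani 2021, App. C: the Yoshida-type positivity criterion with a finite vanishing set (Prop. 46) — TYPED AND PROVED

LINE 1 — FRAMING. The one statement of this file that mentions `RiemannHypothesis`,
`CC2021_prop_C46`, is an **RH-EQUIVALENT criterion** (an `↔` with RH on the left, both sides open);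
its proof here (`CC2021_prop_C46_holds`) is RH-FREE mathematics (explicit formula + Bombieri's
converse argument) and is NOT progress toward RH: it fixes WHICH inequality on WHICH class of test
functions is equivalent to RH, it does not move RH.  Every other declaration is an RH-FREE object or
lemma.  bears_on: LADDER-RH W-C/W-P (RH-link glue of the Connes–Consani corpus; never a binder of a
`closes`).  WHAT THIS IS NOT: any claim about the truth of RH.

Source: A. Connes, C. Consani, *Weil positivity and trace formula, the archimedean place*, Selecta
Math. (N.S.) 27 (2021) 77 = arXiv:2006.13771 [bib: `ConnesConsani2021`], Appendix C "Positivity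
criterion", **Proposition C.1** (= Proposition 46 of the running numbering of the held text
`paper:arxiv-2006.13771`, chunk p0032:L3–L15; arXiv v1 PDF p. 51; numbering dictionary
`cc/CC2021-NUMBERING-lit-1.md`), which the authors state "following [Yoshida]" (H. Yoshida, *On Hermitian forms
attached to zeta functions*, Adv. Stud. Pure Math. 21 (1992), Prop. 1 and Lemma 1).

## The printed statement (Prop. C.1, PDF p. 51; chunk p0032:L5–L8)

"Let `Z ⊂ ℂ` be the set of non-trivial zeros of the Riemann zeta function and `F ⊂ ℂ` a finite set
disjoint from `Z` and containing `{0,1}`, then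
`RH ⟺ Σ_v 𝒲_v(g ∗ ḡ♯) ≤ 0` for all `g ∈ C_c^∞(ℝ₊*)` with `g̃(z) = 0` for all `z ∈ F`."
Here (App. B, PDF p. 50, chunk p0031) `g̃(s) = ∫₀^∞ g(x) x^{s-1} dx` is the Mellin transform in the
normalisation of [EB] = Bombieri 2000, `g♯(x) = x⁻¹ g(x⁻¹)`, and `𝒲_v` are Bombieri's local terms of
the explicit formula `Σ_ρ f̃(ρ) = f̃(0) + f̃(1) − Σ_v 𝒲_v(f)`, `v ∈ {ℝ, 2, 3, 5, …}`,
`𝒲_p(f) = (log p) Σ_m (f(p^m) + f♯(p^m))` (eqs. (148)–(149)), `𝒲_ℝ` = App. B eq. (150) (`bombieriWR`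
of `ArchimedeanDictionary.lean`, typed there AS PRINTED; that file's "(83)" is the chunk-extractor's count).

## Dictionary (tree vocabulary; nothing is re-declared)

The tree's Weil layer (`Literature/NumberTheory/LFunctions/WeilExplicit.lean`) works in the additive
variable: App. C's test function `g ∈ C_c^∞(ℝ₊*)` (= Bombieri's `f`) corresponds to
`G(t) := e^{t/2} g(e^t)`, a smooth compactly supported `G : ℝ → ℂ` (`IsWeilTest G`), and then
* `g̃(z) = weilMellin G z` (`weilMellin G z = ∫ G(t) e^{(z−1/2)t} dt` is the Mellin transform of
  `x ↦ x^{-1/2} G(log x) = g(x)`, module docstring of `WeilExplicit.lean`);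
* `g ∗ ḡ♯ ↦ weilConv G (weilReflect G)` (multiplicative convolution `∫ f(v) h(u/v) d*v` becomes
  additive convolution, and `ḡ♯(x) = x⁻¹ conj g(x⁻¹)` becomes `weilReflect G (t) = conj G(−t)`;
  App. A eq. (144), PDF p. 49);
* `Σ_p 𝒲_p(f) = weilPrimeTerm K` (`= Σ_n Λ(n) n^{-1/2}(K(log n) + K(−log n))`) and
  `𝒲_ℝ(f) = −weilArchTerm K` for the avatar `K` of `f`; so `Σ_v 𝒲_v(f) = bombieriLocalSum K :=
  weilPrimeTerm K − weilArchTerm K`, and the tree's explicit formula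
  `explicit_formula_holds : Σ_ρ m(ρ) K̂(ρ) = weilFunctional K = weilPolarTerm K − weilPrimeTerm K
  + weilArchTerm K` IS App. B's `Σ_ρ f̃(ρ) = f̃(0) + f̃(1) − Σ_v 𝒲_v(f)`
  (`weilFunctional_eq_weilPolarTerm_sub_bombieriLocalSum`); the identification of `𝒲_ℝ` with the
  printed eq. (150) is CHECKED, not assumed: `bombieriLocalSum_eq_weilPrimeTerm_add_bombieriWR`
  (via `ccWInfty_mulLift` and `weilArchTermBombieri_eq_weilArchTerm_holds`);
* `Z = ZetaZeros.riemannZetaNontrivialZeros` (`= {ζ = 0} ∩ {0 < Re < 1}`, `mem_iff'`);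
* in CC's own Fourier variable `ĝ(s) = mulFourier` one has `ĝ(s) = weilMellin (1/2 − is)`
  (`mulFourier_eq_weilMellin`), so the two poles `z = 0, 1` of `F ⊇ {0,1}` are the conditions
  `ĝ(± i/2) = 0` of the paper's §3 and `z = 1/2` is `ĝ(0) = 0`.
The real inequality `Σ_v 𝒲_v(g ∗ ḡ♯) ≤ 0` is typed on the real part; the sum IS real on such
arguments (`bombieriLocalSum_convReflect_im`).

## Proof typed here versus the printed proof

Printed proof (p0032:L10–L15): "⇒" from the explicit formula and `{0,1} ⊆ F`; "⇐" by Yoshida's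
Prop. 1 verbatim after refining Yoshida's Lemma 1 to an approximation step (given `ε > 0` and
`ρ₀ ∈ Z`, a test `g₀` with `g̃₀|_F = 0`, `g̃₀(ρ₀) = 1`, `|g̃₀(ρ)| ≤ ε/|ρ − ρ₀|²` on `Z ∖ {ρ₀}`).
The proof below follows the SAME architecture — "⇒" is literally the printed argument
(`bombieriLocalSum_convReflect_re_nonpos_of_riemannHypothesis`: Weil's criterion
`weil_criterion_holds` plus the vanishing of the polar term of `g ∗ ḡ♯` when `g̃(0) = 0`), and "⇐"
is Bombieri's converse run INSIDE the vanishing class — but replaces Yoshida's approximation lemma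
by the tree's Laplace-transform route (`WeilCriterionConverse.lean`: polarisation under the dipoles
`g ↦ g + c·g(· − x)`, boundedness of the exponential series `B_g`, no terms off the line by
`BoundedPowerSum.sum_fiber_eq_zero_of_exp_real`), which needs only two properties of the class
`{g̃|_F = 0}`: it is stable under the dipoles (`mellinVanishOn_translateMix`, since
`(g + c g_x)~(s) = g̃(s)(1 + c e^{(s−1/2)x})`) and it DETECTS every non-trivial zero
(`exists_mellinVanishOn_pairCoeff_ne_zero`: the differential operator `d/dt + (z − 1/2)` multiplies
`weilMellin` by `(z − s)`, `weilMellin_mellinKill`, so composing over `z ∈ F` kills `g̃` on `F` and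
nowhere else; `ρ, 1 − ρ̄ ∉ F` because `F ∩ Z = ∅` and `Z` is stable under `ρ ↦ 1 − ρ̄`).  Finiteness
of `F` enters exactly there (a finite-order operator).  The class-restricted converse
`riemannHypothesis_of_weilPositivity_on_stableClass` is the Literature-side twin of the summit-side
`Summit.RiemannHypothesis.RiemannHypothesis.Theorems.riemannHypothesis_of_stable_class`
(`Theorems/SoloInformedPoleFree.lean`, which a Literature file may not import, CONVENTIONS §2); the
case `F = {0,1}` of Prop. 46 is that file's `riemannHypothesis_iff_poleFree` (Bombieri 2000
Thms 1–2), cited, not restated.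

## Contents

* `bombieriLocalSum`, `weilFunctional_eq_weilPolarTerm_sub_bombieriLocalSum`,
  `bombieriLocalSum_eq_weilPrimeTerm_add_bombieriWR` — `Σ_v 𝒲_v` and its dictionary;
* `MellinVanishOn F g` — the vanishing conditions `g̃|_F = 0`; `mellinVanishOn_translateMix`;
* `mellinKill z`, `mellinKillList l` — the Mellin killers, `weilMellin_mellinKillList`,
  `exists_mellinVanishOn_pairCoeff_ne_zero(_of_disjoint)`;
* `bombieriLocalSum_convReflect_eq_neg_weilQuadratic`, `…_re_nonpos_iff`, `…_im`,
  `…_re_nonpos_of_riemannHypothesis` ("⇒");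
* `riemannHypothesis_of_weilPositivity_on_stableClass` (Bombieri's converse in a class);
* `CC2021_prop_C46` (the named statement, RH-EQUIVALENT criterion) and `CC2021_prop_C46_holds`
  (its proof), with the sharper form `riemannHypothesis_iff_bombieriLocalSum_nonpos` (only `0 ∈ F`
  is used) and the real-vanishing-set instance `riemannHypothesis_iff_bombieriLocalSum_nonpos_real`
  (any finite set of REAL points containing `0` qualifies: `Z` has no real points,
  `riemannZetaNontrivialZeros.im_ne_zero`; e.g. `F = {0, 1/2, 1}`, the set relevant to CC's Thm 1
  vanishing conditions `ĝ(i/2) = ĝ(0) = 0`, Intro p. 4 chunk p0004:L11).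

* (append 1) `mem_vanishingIdeal_iff_mellinVanishOn` — consistency with §3's ideal `𝒥`
  (`vanishingIdeal`, `VanishingConditions.lean`): `𝒥 = {tests with g̃|_{{0,1}} = 0}`;
  `riemannHypothesis_iff_weilQuadratic_nonneg_ccVanishing` — Prop. 46 at `F = {0, 1/2, 1}` in the
  tree's Weil-positivity coordinates (`RH ⟺ Re Q(g) ≥ 0` for tests with
  `g̃(0) = g̃(1/2) = g̃(1) = 0`, i.e. CC's `ĝ(± i/2) = ĝ(0) = 0`), the form the cell's isolation seat
  consumes.

* (append 2) THE PRINTED APPROXIMATION STEP, PROVED: `exists_mellinVanishOn_approx` — given a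
  finite `F` with `F ∩ Z = ∅`, `ε > 0` and `ρ₀ ∈ Z`, a test `g₀` with `g̃₀|_F = 0`, `g̃₀(ρ₀) = 1` and
  `|g̃₀(ρ)| ≤ ε/|ρ − ρ₀|²` for all `ρ ∈ Z ∖ {ρ₀}` (p0032:L10–L15 = Yoshida 1992 Lemma 1 with `F`
  adjoined to the killed set), by Yoshida's construction: `α₀` with `α̂₀(ρ₀) = 1` and strip decay
  `(1 + γ²)‖s − 1/2‖² |α̂₀(s)| ≤ C` (`norm_weilMellin_decay`), a radius `R` beyond which
  `|α̂₀(ρ)| ≤ ε/|ρ − ρ₀|²` (`exists_radius_norm_weilMellin_le`), the killer of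
  `F ∪ (Z ∩ B(ρ₀, R) ∖ {ρ₀})` normalised at `ρ₀`, and `N`-fold convolution powers `weilConvPow`
  (`weilMellin_weilConvPow`) to absorb the strip constant.

No `sorry`, no new axiom, no numerical input.  Nothing in this file bears on the truth of RH.
-/

noncomputable section

open Complex Set MeasureTheory Filter
open scoped Real Topology ComplexConjugate

namespace Literature.NumberTheory.ConnesConsani2021

open Literature.NumberTheory.LFunctions Literature.NumberTheory.LFunctions.WeilConverse

/-! ## `Σ_v 𝒲_v`: the local terms of App. B in the additive avatar -/

/-- RH-FREE object. **`Σ_v 𝒲_v(f)`**, the sum over all places `v ∈ {ℝ, 2, 3, 5, …}` of Bombieri's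
local terms of the explicit formula `Σ_ρ f̃(ρ) = f̃(0) + f̃(1) − Σ_v 𝒲_v(f)` (App. B eq. (148), PDF p. 50), written
for the additive avatar `k(t) = e^{t/2} f(e^t)` of the test function:
`Σ_p 𝒲_p(f) = weilPrimeTerm k` and `𝒲_ℝ(f) = −weilArchTerm k` (dictionary checked against the
printed `𝒲_ℝ` in `bombieriLocalSum_eq_weilPrimeTerm_add_bombieriWR`).
[cite: ConnesConsani2021, App. B eqs. (148)–(150) (explicit formula, 𝒲_p, 𝒲_ℝ; arXiv:2006.13771v1 PDF p. 50; chunk p0031:L6–L16)] -/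
def bombieriLocalSum (k : ℝ → ℂ) : ℂ :=
  weilPrimeTerm k - weilArchTerm k

/-- RH-FREE. App. B's explicit formula `Σ_ρ f̃(ρ) = f̃(0) + f̃(1) − Σ_v 𝒲_v(f)` in the tree's
normalisation: the Weil functional `W = weilPolarTerm − weilPrimeTerm + weilArchTerm` (whose value
on a test `k` IS the zero sum `Σ_ρ m(ρ) k̂(ρ)`, `explicit_formula_holds`) equals
`weilPolarTerm − bombieriLocalSum`.
[cite: ConnesConsani2021, App. B eq. (148) (explicit formula; arXiv:2006.13771v1 PDF p. 50; chunk p0031:L6–L9)] -/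
theorem weilFunctional_eq_weilPolarTerm_sub_bombieriLocalSum (k : ℝ → ℂ) :
    weilFunctional k = weilPolarTerm k - bombieriLocalSum k := by
  unfold weilFunctional bombieriLocalSum
  ring

/-- RH-FREE dictionary check against `𝒲_ℝ` AS PRINTED (App. B eq. (150) of arXiv v1 — the tree's `ArchimedeanDictionary.lean` calls it "(83)", a chunk-extractor count —
`bombieriWR f = (log 4π + γ) f(1) + ∫₁^∞ (f + f♯ − (2/x) f(1)) dx/(x − x⁻¹)`): for a test `k`, the
avatar of `f = Δ^{-1/2}(k ∘ log)` (i.e. `f(x) = x^{-1/2} k(log x)`), one has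
`Σ_v 𝒲_v(f) = Σ_p 𝒲_p(f) + 𝒲_ℝ(f)` with the archimedean term literally the printed distribution
evaluated at `f` (`ccWInfty_mulLift`, `weilArchTermBombieri_eq_weilArchTerm_holds`).
[cite: ConnesConsani2021, App. B eq. (150) (𝒲_ℝ; arXiv:2006.13771v1 PDF p. 50; chunk p0031:L14–L16)] -/
theorem bombieriLocalSum_eq_weilPrimeTerm_add_bombieriWR {k : ℝ → ℂ} (hk : IsWeilTest k) :
    bombieriLocalSum k = weilPrimeTerm k + bombieriWR (deltaInvHalf (mulLift k)) := by
  have h1 : bombieriWR (deltaInvHalf (mulLift k)) = -archW k := by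
    rw [← ccWInfty_mulLift k]
    simp [ccWInfty]
  rw [h1, show archW k = weilArchTerm k from weilArchTermBombieri_eq_weilArchTerm_holds hk,
    bombieriLocalSum]
  ring

/-! ## The vanishing conditions `g̃|_F = 0` -/

/-- RH-FREE object. **The vanishing conditions of App. C**: `g̃(z) = 0` for every `z ∈ F`, for the
Mellin transform `g̃` of App. B, i.e. `weilMellin g z = 0` in the additive avatar (for `z = 0, 1`
these are the two poles of the explicit formula, `weilPolarTerm k = k̂(0) + k̂(1)`; in CC's Fourier
variable `ĝ(s) = weilMellin (1/2 − is)`, `mulFourier_eq_weilMellin`, they read `ĝ(∓ i/2) = 0`).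
[cite: ConnesConsani2021, App. C Prop. C.1 (= arXiv:2006.13771v1 running item 46; PDF p. 51; chunk p0032:L7)] -/
def MellinVanishOn (F : Set ℂ) (g : ℝ → ℂ) : Prop :=
  ∀ z ∈ F, weilMellin g z = 0

/-- RH-FREE. **The vanishing class is stable under Bombieri's dipoles** `g ↦ g + c·g(· − x)`:
`(g + c g_x)~(s) = g̃(s) (1 + c e^{(s − 1/2)x})` (`weilMellin_translateMix`). (Private: a step of
the proof of `CC2021_prop_C46_holds`.) [folklore] -/
private theorem mellinVanishOn_translateMix {F : Set ℂ} {g : ℝ → ℂ} (hg : IsWeilTest g)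
    (hF : MellinVanishOn F g) (c : ℂ) (x : ℝ) : MellinVanishOn F (translateMix g c x) :=
  fun z hz ↦ by rw [weilMellin_translateMix hg, hF z hz, zero_mul]

/-! ## The Mellin killers `d/dt + (z − 1/2)` -/

/-- RH-FREE object. The first-order differential operator `g ↦ g' + (z − 1/2) g`; it multiplies the
Mellin transform by `(z − s)` (`weilMellin_mellinKill`), hence kills it exactly at `s = z`. (For
`z = 0, 1` the composite is `g'' − g/4`, the pole killer of the summit-side pole-free criterion.)
[folklore] -/
def mellinKill (z : ℂ) (g : ℝ → ℂ) : ℝ → ℂ :=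
  deriv g + fun t ↦ (z - 1 / 2) * g t

/-- RH-FREE. `mellinKill z` preserves test functions (smooth, support inside `supp g`; cf. "its
support is contained in the support of `g`", Lemma 3.3 (ii)). [cite: ConnesConsani2021, §3 Lemma 3.3 (ii) (= arXiv running Lemma 14 (ii); PDF p. 18; chunk p0012:L45, L53–L57), one-point factor of the operator Q, generalised from the pair {0,1} to a finite set; Yoshida1992 p. 285] -/
theorem isWeilTest_mellinKill (z : ℂ) {g : ℝ → ℂ} (hg : IsWeilTest g) :
    IsWeilTest (mellinKill z g) :=
  hg.deriv.add (hg.const_mul _)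

/-- RH-FREE. `(g' + (z − 1/2) g)~(s) = (z − s) g̃(s)` (integration by parts, `weilMellin_deriv`:
`(g')~(s) = −(s − 1/2) g̃(s)`): the one-point factor of CC's Lemma 3.3 (ii) "`Q g ∈ 𝒥`"
(`Q = −(ρ∂_ρ)² + 1/4 = −(mellinKill 1) ∘ (mellinKill 0)` in the additive variable), whose printed
proof is the same integration by parts. [cite: ConnesConsani2021, §3 Lemma 3.3 (ii) (= arXiv running Lemma 14 (ii); PDF p. 18; chunk p0012:L45, L53–L57), one-point factor of the operator Q, generalised from the pair {0,1} to a finite set; Yoshida1992 p. 285] -/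
theorem weilMellin_mellinKill (z : ℂ) {g : ℝ → ℂ} (hg : IsWeilTest g) (s : ℂ) :
    weilMellin (mellinKill z g) s = (z - s) * weilMellin g s := by
  have hh : IsWeilTest fun t ↦ (z - 1 / 2) * g t := hg.const_mul _
  rw [mellinKill, weilMellin_add hg.deriv.1.continuous hg.deriv.2 hh.1.continuous hh.2,
    weilMellin_const_mul, weilMellin_deriv hg]
  ring

/-- RH-FREE object. The composite of the killers `mellinKill z` over a list of points.
[folklore] -/
def mellinKillList : List ℂ → (ℝ → ℂ) → ℝ → ℂ
  | [], g => g
  | z :: l, g => mellinKill z (mellinKillList l g)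

/-- RH-FREE. `mellinKillList l` preserves test functions. [cite: ConnesConsani2021, §3 Lemma 3.3 (ii) (= arXiv running Lemma 14 (ii); PDF p. 18; chunk p0012:L45, L53–L57), one-point factor of the operator Q, generalised from the pair {0,1} to a finite set; Yoshida1992 p. 285] -/
theorem isWeilTest_mellinKillList (l : List ℂ) {g : ℝ → ℂ} (hg : IsWeilTest g) :
    IsWeilTest (mellinKillList l g) := by
  induction l with
  | nil => exact hg
  | cons z l ih => exact isWeilTest_mellinKill z ih

/-- RH-FREE. `(mellinKillList l g)~(s) = (∏_{z ∈ l} (z − s)) · g̃(s)` (Lemma 3.3 (ii) iterated over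
the finite list `l`). [cite: ConnesConsani2021, §3 Lemma 3.3 (ii) (= arXiv running Lemma 14 (ii); PDF p. 18; chunk p0012:L45, L53–L57), one-point factor of the operator Q, generalised from the pair {0,1} to a finite set; Yoshida1992 p. 285] -/
theorem weilMellin_mellinKillList (l : List ℂ) {g : ℝ → ℂ} (hg : IsWeilTest g) (s : ℂ) :
    weilMellin (mellinKillList l g) s = (l.map (· - s)).prod * weilMellin g s := by
  induction l with
  | nil => simp [mellinKillList]
  | cons z l ih =>
    rw [mellinKillList, weilMellin_mellinKill z (isWeilTest_mellinKillList l hg), ih,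
      List.map_cons, List.prod_cons]
    ring

/-- RH-FREE. The killed function satisfies the vanishing conditions at every point of the list:
the range of the composite killer lies in the vanishing ideal of `{z ∈ l}` — CC's Lemma 3.3 (ii)
"`Q g ∈ 𝒥`" for a general finite vanishing set. [cite: ConnesConsani2021, §3 Lemma 3.3 (ii) (= arXiv running Lemma 14 (ii); PDF p. 18; chunk p0012:L45, L53–L57), one-point factor of the operator Q, generalised from the pair {0,1} to a finite set; Yoshida1992 p. 285] -/
theorem mellinVanishOn_mellinKillList (l : List ℂ) {g : ℝ → ℂ} (hg : IsWeilTest g) :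
    MellinVanishOn {z | z ∈ l} (mellinKillList l g) := by
  intro z hz
  rw [weilMellin_mellinKillList l hg]
  have h0 : (l.map (· - z)).prod = 0 :=
    List.prod_eq_zero (List.mem_map.2 ⟨z, hz, sub_self z⟩)
  rw [h0, zero_mul]

/-- RH-FREE. `∏_{z ∈ l} (z − s) ≠ 0` when `s ∉ l` (private algebra helper). [folklore] -/
private theorem prod_map_sub_ne_zero {l : List ℂ} {s : ℂ} (hs : s ∉ l) : (l.map (· - s)).prod ≠ 0 := by
  refine List.prod_ne_zero fun h ↦ hs ?_
  obtain ⟨z, hz, hzs⟩ := List.mem_map.1 h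
  rwa [sub_eq_zero.1 hzs] at hz

/-- RH-FREE. The zero-side pairing `P_g(ρ) = g̃(ρ) conj g̃(1 − ρ̄)` of a killed function:
`P_{kill_l g}(ρ) = ∏(z − ρ) · conj ∏(z − (1 − ρ̄)) · P_g(ρ)` (private proof step). [folklore] -/
private theorem pairCoeff_mellinKillList (l : List ℂ) {g : ℝ → ℂ} (hg : IsWeilTest g) (ρ : ℂ) :
    pairCoeff (mellinKillList l g) ρ =
      (l.map (· - ρ)).prod * conj ((l.map (· - (1 - conj ρ))).prod) * pairCoeff g ρ := by
  rw [pairCoeff, pairCoeff, weilMellin_mellinKillList l hg, weilMellin_mellinKillList l hg,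
    map_mul]
  ring

/-- RH-FREE. **The vanishing class detects every point off `F ∪ (1 − F̄)`**: for a finite `F` and
`ρ` with `ρ ∉ F`, `1 − ρ̄ ∉ F` there is a test `g` with `g̃|_F = 0` and `P_g(ρ) ≠ 0` — kill a narrow
bump with `Re g̃ > 0` on the horizontal line through `ρ` and `1 − ρ̄`
(`exists_isWeilTest_re_weilMellin_pos`) by the composite killer of `F`. (The tree's substitute for
the refinement of Yoshida's Lemma 1 in the printed proof, p0032:L10–L15; private proof step.)
[folklore] -/
private theorem exists_mellinVanishOn_pairCoeff_ne_zero {F : Set ℂ} (hF : F.Finite) {ρ : ℂ} (hρ : ρ ∉ F)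
    (hρ' : 1 - conj ρ ∉ F) :
    ∃ g : ℝ → ℂ, IsWeilTest g ∧ MellinVanishOn F g ∧ pairCoeff g ρ ≠ 0 := by
  obtain ⟨g, hg, hpos⟩ := exists_isWeilTest_re_weilMellin_pos ρ.im
  set l : List ℂ := hF.toFinset.toList with hl
  have hmem : ∀ z : ℂ, z ∈ l ↔ z ∈ F := fun z ↦ by
    rw [hl, Finset.mem_toList, Set.Finite.mem_toFinset]
  refine ⟨mellinKillList l g, isWeilTest_mellinKillList l hg, fun z hz ↦ ?_, ?_⟩
  · exact mellinVanishOn_mellinKillList l hg z ((hmem z).2 hz)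
  have h1 : weilMellin g ρ ≠ 0 := by
    intro h0
    have := hpos ρ.re
    rw [show (ρ.re : ℂ) + ρ.im * I = ρ from Complex.re_add_im ρ, h0, Complex.zero_re] at this
    exact lt_irrefl _ this
  have h2 : weilMellin g (1 - conj ρ) ≠ 0 := by
    intro h0
    have := hpos (1 - ρ.re)
    rw [show ((1 - ρ.re : ℝ) : ℂ) + ρ.im * I = 1 - conj ρ from ?_, h0, Complex.zero_re] at this
    · exact lt_irrefl _ this
    · apply Complex.ext <;> simp
  rw [pairCoeff_mellinKillList l hg, pairCoeff]
  exact mul_ne_zero (mul_ne_zero (prod_map_sub_ne_zero fun h ↦ hρ ((hmem _).1 h))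
    ((map_ne_zero _).2 (prod_map_sub_ne_zero fun h ↦ hρ' ((hmem _).1 h))))
    (mul_ne_zero h1 ((map_ne_zero _).2 h2))

/-- RH-FREE. **Zero detection under the printed hypothesis `F ∩ Z = ∅`**: a finite `F` disjoint
from the non-trivial zeros misses `ρ` and `1 − ρ̄` for every non-trivial zero `ρ` (`Z` is stable
under `ρ ↦ 1 − ρ̄`, `riemannZetaNontrivialZeros.one_sub_conj_mem`), so the vanishing class contains
a test with `P_g(ρ) ≠ 0` (private proof step). [folklore] -/
private theorem exists_mellinVanishOn_pairCoeff_ne_zero_of_disjoint {F : Set ℂ} (hF : F.Finite)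
    (hFZ : Disjoint F ZetaZeros.riemannZetaNontrivialZeros) {ρ : ℂ}
    (hρ : ρ ∈ ZetaZeros.riemannZetaNontrivialZeros) :
    ∃ g : ℝ → ℂ, IsWeilTest g ∧ MellinVanishOn F g ∧ pairCoeff g ρ ≠ 0 :=
  exists_mellinVanishOn_pairCoeff_ne_zero hF (fun h ↦ Set.disjoint_left.1 hFZ h hρ)
    fun h ↦ Set.disjoint_left.1 hFZ h (ZetaZeros.riemannZetaNontrivialZeros.one_sub_conj_mem hρ)

/-! ## `Σ_v 𝒲_v(g ∗ ḡ♯)` on the vanishing class -/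

/-- RH-FREE. On a test with `g̃(0) = 0` the polar term of `k = g ∗ ḡ♯` vanishes:
`k̂(0) + k̂(1) = 2 Re(g̃(0) conj g̃(1)) = 0` (`weilPolarTerm_weilConv_weilReflect`).  Private
restatement of the summit-side `weilPolarTerm_eq_zero_of_poleFree` (`Theorems/SoloInformedPoleFree.lean`,
not importable from Literature).
[cite: ConnesConsani2021, App. C, proof of Prop. C.1 (= arXiv running item 46), "⇒" (PDF p. 51; chunk p0032:L10)] -/
private theorem weilPolarTerm_convReflect_eq_zero {g : ℝ → ℂ} (hg : IsWeilTest g)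
    (h0 : weilMellin g 0 = 0) : weilPolarTerm (weilConv g (weilReflect g)) = 0 := by
  rw [weilPolarTerm_weilConv_weilReflect hg, h0, zero_mul, Complex.zero_re, mul_zero,
    Complex.ofReal_zero]

/-- RH-FREE. On a test with `g̃(0) = 0`: `Σ_v 𝒲_v(g ∗ ḡ♯) = −W(g ∗ ḡ♯) = −Q(g)` (explicit formula of
App. B with vanishing polar term; `weilQuadratic g = weilFunctional (g ⋆ g̃)`).
[cite: ConnesConsani2021, App. C, proof of Prop. C.1 (= arXiv running item 46), "⇒" (PDF p. 51; chunk p0032:L10)] -/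
theorem bombieriLocalSum_convReflect_eq_neg_weilQuadratic {g : ℝ → ℂ} (hg : IsWeilTest g)
    (h0 : weilMellin g 0 = 0) :
    bombieriLocalSum (weilConv g (weilReflect g)) = -weilQuadratic g := by
  rw [weilQuadratic, weilFunctional_eq_weilPolarTerm_sub_bombieriLocalSum,
    weilPolarTerm_convReflect_eq_zero hg h0]
  ring

/-- RH-FREE. On a test with `g̃(0) = 0`: `Σ_v 𝒲_v(g ∗ ḡ♯) ≤ 0 ⟺ Re Q(g) ≥ 0`, i.e. the printed
inequality of Prop. 46 is Weil positivity `Re W(g ⋆ g̃) ≥ 0` of the tree (`weilQuadratic`) — the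
content of the printed remark that "⇒" "follows from the explicit formula (bombieriexplicit) and
the hypothesis `{0,1} ⊆ F`".
[cite: ConnesConsani2021, App. C, proof of Prop. C.1 (= arXiv running item 46), "⇒" (PDF p. 51; chunk p0032:L10)] -/
theorem bombieriLocalSum_convReflect_re_nonpos_iff {g : ℝ → ℂ} (hg : IsWeilTest g)
    (h0 : weilMellin g 0 = 0) :
    (bombieriLocalSum (weilConv g (weilReflect g))).re ≤ 0 ↔ 0 ≤ (weilQuadratic g).re := by
  rw [bombieriLocalSum_convReflect_eq_neg_weilQuadratic hg h0, Complex.neg_re]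
  constructor <;> intro h <;> linarith

/-- RH-FREE. `Σ_v 𝒲_v(g ∗ ḡ♯)` is REAL for every test `g` (the polar term of `g ∗ ḡ♯` is the real
number `2 Re(g̃(0) conj g̃(1))` and `Q(g)` is real, `weilQuadratic_im_holds`); so typing the printed
`≤ 0` on the real part loses nothing (reality of the three sides of the explicit formula on
`f ∗ f̄♯`, Bombieri 2000 §2, as recorded by the tree's `weilQuadratic_im`). [cite: Bombieri2000, §2] -/
theorem bombieriLocalSum_convReflect_im {g : ℝ → ℂ} (hg : IsWeilTest g) :
    (bombieriLocalSum (weilConv g (weilReflect g))).im = 0 := by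
  have h : bombieriLocalSum (weilConv g (weilReflect g)) =
      weilPolarTerm (weilConv g (weilReflect g)) - weilQuadratic g := by
    rw [weilQuadratic, weilFunctional_eq_weilPolarTerm_sub_bombieriLocalSum]
    ring
  rw [h, Complex.sub_im, weilPolarTerm_weilConv_weilReflect hg, Complex.ofReal_im,
    weilQuadratic_im_holds hg, sub_zero]

/-- RH-CONSEQUENCE (proved implication `RH → …`; nothing asserted about RH). **Prop. 46, "⇒"**:
under RH, `Σ_v 𝒲_v(g ∗ ḡ♯) ≤ 0` for every test `g` whose Mellin transform vanishes on a set
`F ∋ 0` — "follows from the explicit formula and the hypothesis `{0,1} ⊆ F`" (only `0 ∈ F` is used: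
it already kills the polar term of `g ∗ ḡ♯`); Weil's criterion `weil_criterion_holds` supplies
`Re Q(g) ≥ 0`. [cite: ConnesConsani2021, App. C, proof of Prop. C.1 (= arXiv running item 46), "⇒" (PDF p. 51; chunk p0032:L10)] -/
theorem bombieriLocalSum_convReflect_re_nonpos_of_riemannHypothesis (hRH : RiemannHypothesis)
    {F : Set ℂ} (h0 : (0 : ℂ) ∈ F) {g : ℝ → ℂ} (hg : IsWeilTest g) (hF : MellinVanishOn F g) :
    (bombieriLocalSum (weilConv g (weilReflect g))).re ≤ 0 :=
  (bombieriLocalSum_convReflect_re_nonpos_iff hg (hF 0 h0)).2 (weil_criterion_holds.1 hRH g hg)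

/-! ## Bombieri's converse inside a dipole-stable, zero-detecting class

Literature-side twin of the summit-side `riemannHypothesis_of_stable_class`
(`Summits/RiemannHypothesis/RiemannHypothesis/Theorems/SoloInformedPoleFree.lean`, not importable
here): the converse half of Weil's criterion (`WeilCriterionConverse.lean`, Bombieri 2000 Thm. 1
"if") rerun with its positivity hypothesis restricted to a class of tests. -/

/-- RH-FREE. For a test `g` the zero form `Σ_ρ m(ρ) P_g(ρ)` equals `Q(g) = W(g ⋆ g̃)`: both are
limits of the symmetric partial zero sums of `g ⋆ g̃` (`hasWeilZeroSide_zeroForm`,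
`explicit_formula_holds`). [cite: Bombieri2000Weil, Thm. 2] -/
private theorem zeroForm_eq_weilQuadratic {g : ℝ → ℂ} (hg : IsWeilTest g) :
    zeroForm g = weilQuadratic g :=
  tendsto_nhds_unique (hasWeilZeroSide_zeroForm hg)
    (explicit_formula_holds (hg.weilConv hg.weilReflect))

/-- RH-FREE. Polarisation at one shift `x`: if `Re Σ_ρ m(ρ) P_g(ρ) ≥ 0` and the same holds for
`g + c·g(· − x)` for every `c`, then `‖B_g(x)‖ ≤ Re Σ_ρ m(ρ) P_g(ρ)` for the exponential series
`B_g = expSum g` (take `c = −conj B_g(x)/‖B_g(x)‖` in `zeroForm_translateMix`; the proof of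
`WeilConverse.norm_expSum_le` with its hypothesis localised; private proof step). [folklore] -/
private theorem norm_expSum_le_of_translateMix {g : ℝ → ℂ} (hg : IsWeilTest g) {x : ℝ}
    (hQ : 0 ≤ (zeroForm g).re) (hx : ∀ c : ℂ, 0 ≤ (zeroForm (translateMix g c x)).re) :
    ‖expSum g x‖ ≤ (zeroForm g).re := by
  set B := expSum g x with hBdef
  by_cases hB : B = 0
  · rw [hB, norm_zero]; exact hQ
  have hA : expSum' g x = conj B := by
    rw [hBdef, ← conj_expSum' g x, Complex.conj_conj]
  have hn0 : ‖B‖ ≠ 0 := norm_ne_zero_iff.2 hB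
  have hn : (‖B‖ : ℂ) ≠ 0 := by exact_mod_cast hn0
  set c : ℂ := -conj B / (‖B‖ : ℂ) with hc
  have hcB : c * B = -(‖B‖ : ℂ) := by
    rw [hc, div_mul_eq_mul_div, neg_mul, Complex.conj_mul', neg_div]
    congr 1
    rw [sq, mul_div_assoc, div_self hn, mul_one]
  have hc1 : Complex.normSq c = 1 := by
    rw [Complex.normSq_eq_norm_sq, hc, norm_div, norm_neg, Complex.norm_conj, Complex.norm_real,
      Real.norm_eq_abs, abs_norm, div_self hn0, one_pow]
  have h0 := hx c
  rw [zeroForm_translateMix hg c x, hA, ← map_mul, hcB, hc1] at h0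
  simp only [map_neg, Complex.conj_ofReal, Complex.ofReal_one, one_mul, add_re, neg_re,
    Complex.ofReal_re] at h0
  linarith

/-- RH-FREE. No terms off the line: if `‖B_g(x)‖ ≤ M` for all real `x` then `m(ρ₀) P_g(ρ₀) = 0`
for every non-trivial zero `ρ₀` with `Re ρ₀ ≠ 1/2` (`BoundedPowerSum.sum_fiber_eq_zero_of_exp_real`
with the locally finite exponents `ρ − 1/2`; the fibre over `ρ₀ − 1/2` is `{ρ₀}`; as in
`WeilConverse.order_mul_pairCoeff_eq_zero`; private proof step). [folklore] -/
private theorem order_mul_pairCoeff_eq_zero_of_norm_expSum_le {g : ℝ → ℂ} (hg : IsWeilTest g) {M : ℝ}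
    (hB : ∀ x : ℝ, ‖expSum g x‖ ≤ M) {ρ₀ : ℂ}
    (hρ₀ : ρ₀ ∈ ZetaZeros.riemannZetaNontrivialZeros) (hre : ρ₀.re ≠ 1 / 2) :
    (riemannZetaZeroOrder ρ₀ : ℂ) * pairCoeff g ρ₀ = 0 := by
  have h := Literature.Analysis.Complex.BoundedPowerSum.sum_fiber_eq_zero_of_exp_real
    (ι := ZetaZeros.riemannZetaNontrivialZeros)
    (c := fun ρ ↦ (riemannZetaZeroOrder (ρ : ℂ) : ℂ) * pairCoeff g ρ)
    (lam := fun ρ ↦ (ρ : ℂ) - 1 / 2) (R := 1 / 2) (M := M)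
    (summable_norm_pairCoeff hg) (fun ρ ↦ abs_re_sub_half_le ρ.2) (fun z ↦ ?_)
    (fun x ↦ hB x) (μ := ρ₀ - 1 / 2) (by simpa [sub_re] using sub_ne_zero.2 hre)
    {⟨ρ₀, hρ₀⟩} (fun ρ ↦ ?_)
  · simpa using h
  · refine ⟨1, one_pos, ?_⟩
    refine ((riemannZetaNontrivialZeros_finite_inter_ball (z + 1 / 2) 1).preimage
      (Subtype.val_injective.injOn)).subset fun ρ hρ ↦ ?_
    simp only [mem_setOf_eq, Metric.mem_ball, dist_eq_norm] at hρ
    refine ⟨ρ.2, ?_⟩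
    rw [Metric.mem_ball, dist_eq_norm]
    rwa [show (ρ : ℂ) - (z + 1 / 2) = (ρ : ℂ) - 1 / 2 - z by ring]
  · rw [Finset.mem_singleton, sub_left_inj]
    constructor
    · rintro rfl; rfl
    · intro h; exact Subtype.ext h

/-- RH-FREE theorem (an implication; its hypothesis `H` is a Weil-positivity assumption on a class,
nothing is asserted). **Bombieri's converse inside a dipole-stable, zero-detecting class**: if a
class `P` of tests is stable under `g ↦ g + c·g(· − x)`, `Re Q(g) ≥ 0` on the tests of `P`, and for
every non-trivial zero `ρ` some test of `P` has `P_g(ρ) ≠ 0`, then every non-trivial zero has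
`Re ρ = 1/2`, i.e. Mathlib's `RiemannHypothesis` (`riemannHypothesis_iff_strip_holds`).  Private:
the class-restricted form is the tree's proof device (public twin summit-side,
`riemannHypothesis_of_stable_class`), not a printed statement. [folklore] -/
private theorem riemannHypothesis_of_weilPositivity_on_stableClass {P : (ℝ → ℂ) → Prop}
    (hP : ∀ (g : ℝ → ℂ) (c : ℂ) (x : ℝ), IsWeilTest g → P g → P (translateMix g c x))
    (H : ∀ g : ℝ → ℂ, IsWeilTest g → P g → 0 ≤ (weilQuadratic g).re)
    (hdet : ∀ ρ ∈ ZetaZeros.riemannZetaNontrivialZeros,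
      ∃ g : ℝ → ℂ, IsWeilTest g ∧ P g ∧ pairCoeff g ρ ≠ 0) :
    RiemannHypothesis := by
  have hQ : ∀ g : ℝ → ℂ, IsWeilTest g → P g → 0 ≤ (zeroForm g).re := fun g hg hPg ↦ by
    rw [zeroForm_eq_weilQuadratic hg]
    exact H g hg hPg
  refine riemannHypothesis_iff_strip_holds.2 fun s hs hs0 hs1 ↦ ?_
  have hρ : s ∈ ZetaZeros.riemannZetaNontrivialZeros :=
    ZetaZeros.riemannZetaNontrivialZeros.mem_iff'.2 ⟨hs, hs0, hs1⟩
  by_contra hre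
  obtain ⟨g, hg, hPg, hne⟩ := hdet s hρ
  have hB : ∀ x : ℝ, ‖expSum g x‖ ≤ (zeroForm g).re := fun x ↦
    norm_expSum_le_of_translateMix hg (hQ g hg hPg)
      fun c ↦ hQ _ (isWeilTest_translateMix hg c x) (hP g c x hg hPg)
  have h := order_mul_pairCoeff_eq_zero_of_norm_expSum_le hg hB hρ hre
  have hm : (riemannZetaZeroOrder s : ℂ) ≠ 0 := by
    have := ZetaZeros.riemannZetaNontrivialZeros.one_le_order hρ
    exact_mod_cast (by omega : riemannZetaZeroOrder s ≠ 0)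
  exact mul_ne_zero hm hne h

/-! ## Prop. 46: the statement as printed, and its proof -/

/-- **RH-EQUIVALENT criterion (line 1)** — Connes–Consani 2021, App. C, Prop. 46 (Yoshida-type
positivity criterion with a finite set of vanishing conditions), AS PRINTED (App. C Prop. C.1 = arXiv running item 46, PDF p. 51,
chunk p0032:L5–L8): "Let `Z ⊂ ℂ` be the set of non-trivial zeros of the Riemann zeta function and
`F ⊂ ℂ` a finite set disjoint from `Z` and containing `{0,1}`, then
`RH ⟺ Σ_v 𝒲_v(g ∗ ḡ♯) ≤ 0` for all `g ∈ C_c^∞(ℝ₊*)` with `g̃(z) = 0`, `z ∈ F`."  Typing (module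
docstring "Dictionary"): `Z = ZetaZeros.riemannZetaNontrivialZeros`; `F : Set ℂ` with `F.Finite`;
`g` ↦ its additive avatar `G`, `IsWeilTest G`; `g̃(z) ↦ weilMellin G z` (`MellinVanishOn F G`);
`g ∗ ḡ♯ ↦ weilConv G (weilReflect G)`; `Σ_v 𝒲_v ↦ bombieriLocalSum`; `≤ 0` on the real part (the
sum is real there, `bombieriLocalSum_convReflect_im`).  PROVED below (`CC2021_prop_C46_holds`); the
case `F = {0,1}` is the summit-side `riemannHypothesis_iff_poleFree` (Bombieri 2000 Thms 1–2), of
which this is the finite-vanishing-set generalisation the authors take from Yoshida 1992 (Prop. 1).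
An equivalence with RH: neither side is asserted; nothing here bears on the truth of RH.
[cite: ConnesConsani2021, App. C Prop. C.1 (= arXiv:2006.13771v1 running item 46; PDF p. 51, eq. (156); chunk p0032:L5–L8); after Yoshida1992 Prop. 1 / Lemma 1] -/
def CC2021_prop_C46 : Prop :=
  ∀ F : Set ℂ, F.Finite → (0 : ℂ) ∈ F → (1 : ℂ) ∈ F →
    Disjoint F ZetaZeros.riemannZetaNontrivialZeros →
      (RiemannHypothesis ↔
        ∀ g : ℝ → ℂ, IsWeilTest g → MellinVanishOn F g →
          (bombieriLocalSum (weilConv g (weilReflect g))).re ≤ 0)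

/-- RH-EQUIVALENT criterion (line 1; an `↔` with RH, proved; neither side asserted). The sharper
form actually proved: Prop. 46 with the hypothesis `{0,1} ⊆ F` weakened to `0 ∈ F` (the point `1`
is never used: `g̃(0) = 0` alone kills the polar term of `g ∗ ḡ♯`).  "⇒":
`bombieriLocalSum_convReflect_re_nonpos_of_riemannHypothesis`; "⇐": Bombieri's converse inside
the vanishing class (`riemannHypothesis_of_weilPositivity_on_stableClass` with
`mellinVanishOn_translateMix` and `exists_mellinVanishOn_pairCoeff_ne_zero_of_disjoint`).
[cite: ConnesConsani2021, App. C Prop. C.1 (= arXiv:2006.13771v1 running item 46; PDF p. 51; chunk p0032:L5–L15)] -/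
theorem riemannHypothesis_iff_bombieriLocalSum_nonpos {F : Set ℂ} (hF : F.Finite)
    (h0 : (0 : ℂ) ∈ F) (hFZ : Disjoint F ZetaZeros.riemannZetaNontrivialZeros) :
    RiemannHypothesis ↔
      ∀ g : ℝ → ℂ, IsWeilTest g → MellinVanishOn F g →
        (bombieriLocalSum (weilConv g (weilReflect g))).re ≤ 0 := by
  constructor
  · exact fun hRH g hg hFg ↦
      bombieriLocalSum_convReflect_re_nonpos_of_riemannHypothesis hRH h0 hg hFg
  · intro H
    exact riemannHypothesis_of_weilPositivity_on_stableClass (P := MellinVanishOn F)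
      (fun g c x hg hPg ↦ mellinVanishOn_translateMix hg hPg c x)
      (fun g hg hPg ↦ (bombieriLocalSum_convReflect_re_nonpos_iff hg (hPg 0 h0)).1 (H g hg hPg))
      fun ρ hρ ↦ exists_mellinVanishOn_pairCoeff_ne_zero_of_disjoint hF hFZ hρ

/-- DISCHARGE of `CC2021_prop_C46` (RH-EQUIVALENT criterion, line 1; the proof is RH-FREE
mathematics and asserts neither side). [cite: ConnesConsani2021, App. C Prop. C.1 (= arXiv:2006.13771v1 running item 46; PDF p. 51; chunk p0032:L5–L15)] -/
theorem CC2021_prop_C46_holds : CC2021_prop_C46 :=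
  fun _F hF h0 _h1 hFZ ↦ riemannHypothesis_iff_bombieriLocalSum_nonpos hF h0 hFZ

/-- RH-FREE. A set of REAL points is disjoint from the non-trivial zeros (`ζ` has no zeros on the
real segment `(0,1)`, `riemannZetaNontrivialZeros.im_ne_zero`); in particular `F ∩ Z = ∅` holds
for `F = {0, 1/2, 1}` (`ζ(1/2) ≠ 0`: `riemannZeta_ofReal_ne_zero_of_pos_of_lt_one`): "ζ(s) has no
zeros on the real axis between 0 and 1". [cite: Titchmarsh1986, §2.12 (text after (2.12.4))] -/
theorem disjoint_riemannZetaNontrivialZeros_of_im_eq_zero {F : Set ℂ} (hF : ∀ z ∈ F, z.im = 0) :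
    Disjoint F ZetaZeros.riemannZetaNontrivialZeros :=
  Set.disjoint_left.2 fun z hz hZ ↦ ZetaZeros.riemannZetaNontrivialZeros.im_ne_zero hZ (hF z hz)

/-- RH-EQUIVALENT criterion (line 1; proved `↔`, neither side asserted). Prop. 46 for a finite set
of REAL vanishing points containing `0` (e.g. `F = {0, 1/2, 1}`, the Mellin points of CC's
conditions `ĝ(−i/2) = ĝ(0) = ĝ(i/2) = 0`; the hypothesis `F ∩ Z = ∅` is then automatic,
`disjoint_riemannZetaNontrivialZeros_of_im_eq_zero`). [cite: ConnesConsani2021, App. C Prop. C.1 (= arXiv running item 46; PDF p. 51) with Intro eq. (2) and the remark after Thm 1 (PDF pp. 2–3) (chunks p0032:L5–L8, p0004:L11)] -/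
theorem riemannHypothesis_iff_bombieriLocalSum_nonpos_real {F : Set ℂ} (hF : F.Finite)
    (h0 : (0 : ℂ) ∈ F) (hreal : ∀ z ∈ F, z.im = 0) :
    RiemannHypothesis ↔
      ∀ g : ℝ → ℂ, IsWeilTest g → MellinVanishOn F g →
        (bombieriLocalSum (weilConv g (weilReflect g))).re ≤ 0 :=
  riemannHypothesis_iff_bombieriLocalSum_nonpos hF h0
    (disjoint_riemannZetaNontrivialZeros_of_im_eq_zero hreal)

/-! ## Append 1: consistency with §3's ideal `𝒥`, and Prop. 46 at `F = {0, 1/2, 1}` in Weil-positivity coordinates -/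

/-- RH-FREE. **Consistency with §3.** CC's ideal `𝒥` of the vanishing conditions (3.2)
(`vanishingIdeal` of `VanishingConditions.lean`: tests with `ĝ(i/2) = ĝ(−i/2) = 0`) is the class of
test functions satisfying the App. C vanishing conditions for `F = {0, 1}` (the two poles):
`𝒥 = {g test : g̃|_{{0,1}} = 0}` (`mem_vanishingIdeal_iff_weilMellin`).
[cite: ConnesConsani2021, §3 eq. (54) (vanishing conditions; PDF p. 18) with App. C Prop. C.1 (= arXiv running item 46; PDF p. 51) (chunks p0012:L28–L31, p0032:L5–L8)] -/
theorem mem_vanishingIdeal_iff_mellinVanishOn {g : ℝ → ℂ} :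
    g ∈ vanishingIdeal ↔ IsWeilTest g ∧ MellinVanishOn ({0, 1} : Set ℂ) g := by
  rw [mem_vanishingIdeal_iff_weilMellin]
  constructor
  · rintro ⟨hg, h1, h0⟩
    refine ⟨hg, fun z hz ↦ ?_⟩
    simp only [Set.mem_insert_iff, Set.mem_singleton_iff] at hz
    rcases hz with rfl | rfl
    · exact h0
    · exact h1
  · rintro ⟨hg, hF⟩
    exact ⟨hg, hF 1 (by simp), hF 0 (by simp)⟩

/-- RH-EQUIVALENT criterion (line 1; proved `↔`, neither side asserted). **Prop. 46 at
`F = {0, 1/2, 1}`, in the tree's Weil-positivity coordinates**: `RH ⟺ Re W(g ⋆ g̃) ≥ 0` for every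
test `g` with `g̃(0) = g̃(1/2) = g̃(1) = 0` — in CC's Fourier variable the three conditions
`ĝ(−i/2) = ĝ(0) = ĝ(i/2) = 0` (`mulFourier_eq_weilMellin`), i.e. the vanishing class of Theorem 1
/ eq. (4) enlarged by the pole `ĝ(−i/2)`; "since `ξ(1/2 + is) ≠ 0` for `s = 0, i/2`, the imposed
vanishing conditions do not compromise our strategy towards RH" (Intro p. 4).  Obtained from
`riemannHypothesis_iff_bombieriLocalSum_nonpos_real` (`F ∩ Z = ∅` is automatic for real `F`) and
the conversion `Σ_v 𝒲_v(g ∗ ḡ♯) ≤ 0 ⟺ Re Q(g) ≥ 0` on tests with `g̃(0) = 0`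
(`bombieriLocalSum_convReflect_re_nonpos_iff`).  WHAT THIS IS NOT: a claim about either side.
[cite: ConnesConsani2021, App. C Prop. C.1 (= arXiv running item 46; PDF p. 51) with Intro eq. (2) and the remark after Thm 1 (PDF pp. 2–3) (chunks p0032:L5–L8, p0004:L11)] -/
theorem riemannHypothesis_iff_weilQuadratic_nonneg_ccVanishing :
    RiemannHypothesis ↔
      ∀ g : ℝ → ℂ, IsWeilTest g → weilMellin g 0 = 0 → weilMellin g (1 / 2) = 0 →
        weilMellin g 1 = 0 → 0 ≤ (weilQuadratic g).re := by
  have hF : ({0, 1 / 2, 1} : Set ℂ).Finite :=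
    ((Set.finite_singleton (1 : ℂ)).insert (1 / 2)).insert 0
  have h0 : (0 : ℂ) ∈ ({0, 1 / 2, 1} : Set ℂ) := by simp
  have hreal : ∀ z ∈ ({0, 1 / 2, 1} : Set ℂ), z.im = 0 := by
    intro z hz
    simp only [Set.mem_insert_iff, Set.mem_singleton_iff] at hz
    rcases hz with rfl | rfl | rfl <;> simp
  rw [riemannHypothesis_iff_bombieriLocalSum_nonpos_real hF h0 hreal]
  constructor
  · intro H g hg hg0 hghalf hg1
    have hv : MellinVanishOn ({0, 1 / 2, 1} : Set ℂ) g := by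
      intro z hz
      simp only [Set.mem_insert_iff, Set.mem_singleton_iff] at hz
      rcases hz with rfl | rfl | rfl
      · exact hg0
      · exact hghalf
      · exact hg1
    exact (bombieriLocalSum_convReflect_re_nonpos_iff hg hg0).1 (H g hg hv)
  · intro H g hg hv
    exact (bombieriLocalSum_convReflect_re_nonpos_iff hg (hv 0 h0)).2
      (H g hg (hv 0 h0) (hv _ (by simp)) (hv 1 (by simp)))

/-- RH-FREE theorem (an implication whose hypothesis is an RH-strength positivity statement;
nothing asserted). The "⇐" half of `riemannHypothesis_iff_weilQuadratic_nonneg_ccVanishing`, the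
shape consumed by the cell's isolation seat: Weil positivity on CC's vanishing class
`ĝ(± i/2) = ĝ(0) = 0` implies RH.
[cite: ConnesConsani2021, App. C Prop. C.1 (= arXiv running item 46), "⇐" (PDF p. 51; chunk p0032:L10–L15)] -/
theorem riemannHypothesis_of_weilQuadratic_nonneg_ccVanishing
    (H : ∀ g : ℝ → ℂ, IsWeilTest g → weilMellin g 0 = 0 → weilMellin g (1 / 2) = 0 →
      weilMellin g 1 = 0 → 0 ≤ (weilQuadratic g).re) :
    RiemannHypothesis :=
  riemannHypothesis_iff_weilQuadratic_nonneg_ccVanishing.2 H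

/-! ## Append 2: the approximation step of the printed proof (Yoshida's Lemma 1, refined), PROVED -/

/-- RH-FREE object. Convolution powers `weilConvPow g n = g ⋆ ⋯ ⋆ g` (`n + 1` factors; "`α₀` is
convoluted `N`-times" in Yoshida's proof of Lemma 1).
[cite: Yoshida1992HermitianForms, proof of Lemma 1 p. 285] -/
def weilConvPow (g : ℝ → ℂ) : ℕ → ℝ → ℂ
  | 0 => g
  | n + 1 => weilConv g (weilConvPow g n)

/-- RH-FREE. Convolution powers of a test function are test functions (`IsWeilTest.weilConv`).
[cite: Yoshida1992HermitianForms, proof of Lemma 1 p. 285] -/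
theorem isWeilTest_weilConvPow {g : ℝ → ℂ} (hg : IsWeilTest g) (n : ℕ) :
    IsWeilTest (weilConvPow g n) := by
  induction n with
  | zero => exact hg
  | succ n ih => exact hg.weilConv ih

/-- RH-FREE. `(g^{⋆(n+1)})~(s) = g̃(s)^{n+1}` (multiplicativity of the Mellin transform,
`weilMellin_weilConv_holds`; Yoshida (1.3), "`Φ(s) = Φ₀(s)^N ∏ Φ_i(s)`").
[cite: Yoshida1992HermitianForms, §1 eq. (1.3) and proof of Lemma 1 p. 285] -/
theorem weilMellin_weilConvPow {g : ℝ → ℂ} (hg : IsWeilTest g) (n : ℕ) (s : ℂ) :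
    weilMellin (weilConvPow g n) s = weilMellin g s ^ (n + 1) := by
  induction n with
  | zero => simp [weilConvPow]
  | succ n ih =>
    have hn := isWeilTest_weilConvPow hg n
    rw [weilConvPow, weilMellin_weilConv_holds hg.1.continuous hg.2 hn.1.continuous hn.2, ih]
    ring

/-- RH-FREE. Fourth-order decay of the Mellin transform of a test function in the closed strip
`0 ≤ Re s ≤ 1`: `(1 + (Im s)²) · ‖s − 1/2‖² · ‖g̃(s)‖ ≤ C_{g″}` (`C_{g″} = weilDecayConst g″`;
two integrations by parts `(g″)~(s) = (s − 1/2)² g̃(s)`, `weilMellin_deriv_deriv`, on top of the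
tree's second-order bound `norm_weilMellin_le` for `g″`) — Yoshida's
"`M(α₀‴)(s) = −(s − 1/2)³ M(α₀)(s)`, hence `M(α₀) = O(|s − 1/2|⁻³)` for `0 ≤ Re s ≤ 1`".
[cite: Yoshida1992HermitianForms, proof of Lemma 1 p. 285] -/
theorem norm_weilMellin_decay {g : ℝ → ℂ} (hg : IsWeilTest g) {s : ℂ} (hs0 : 0 ≤ s.re)
    (hs1 : s.re ≤ 1) :
    (1 + s.im ^ 2) * (‖s - 1 / 2‖ ^ 2 * ‖weilMellin g s‖) ≤
      weilDecayConst (deriv (deriv g)) := by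
  have hpos : 0 < 1 + s.im ^ 2 := by positivity
  have h := norm_weilMellin_le hg.deriv.deriv hs0 hs1
  rw [weilMellin_deriv_deriv hg, norm_mul, norm_pow, le_div_iff₀ hpos] at h
  linarith

/-- RH-FREE. **Yoshida's (1.7)**: for a test `h`, `ε > 0` and a non-trivial zero `ρ₀` there is
`R ≥ 1` with `‖h̃(ρ)‖ ≤ ε/‖ρ − ρ₀‖²` for every non-trivial zero `ρ` with `‖ρ − ρ₀‖ ≥ R` ("Hence we
can find `R > 1` such that (1.7) `|M(α₀)(ρ)| ≤ ε/|ρ − ρ₀|²` for every `ρ` such that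
`|ρ − ρ₀| ≥ R`"; from `norm_weilMellin_decay`: with `G = max(1, 4C/ε, ‖ρ₀ − 1/2‖)` and
`R = G + |Im ρ₀| + 1`, a zero at distance `≥ R` has `|Im ρ| ≥ G`, so
`‖h̃(ρ)‖ ‖ρ − ρ₀‖² ≤ 4 ‖ρ − 1/2‖² ‖h̃(ρ)‖ ≤ 4C/G² ≤ ε`).
[cite: Yoshida1992HermitianForms, proof of Lemma 1, eq. (1.7) p. 285] -/
theorem exists_radius_norm_weilMellin_le {h : ℝ → ℂ} (hh : IsWeilTest h) {ε : ℝ} (hε : 0 < ε)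
    {ρ₀ : ℂ} (hρ₀ : ρ₀ ∈ ZetaZeros.riemannZetaNontrivialZeros) :
    ∃ R : ℝ, 1 ≤ R ∧ ∀ ρ ∈ ZetaZeros.riemannZetaNontrivialZeros, R ≤ ‖ρ - ρ₀‖ →
      ‖weilMellin h ρ‖ ≤ ε / ‖ρ - ρ₀‖ ^ 2 := by
  set C := weilDecayConst (deriv (deriv h)) with hC
  have hC0 : 0 ≤ C := weilDecayConst_nonneg _
  set A := ‖ρ₀ - 1 / 2‖ with hA
  set G := max 1 (max (4 * C / ε) A) with hG
  have hG1 : 1 ≤ G := le_max_left _ _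
  have hGC : 4 * C / ε ≤ G := (le_max_left _ _).trans (le_max_right _ _)
  have hGA : A ≤ G := (le_max_right _ _).trans (le_max_right _ _)
  have hG0 : 0 ≤ G := zero_le_one.trans hG1
  refine ⟨G + |ρ₀.im| + 1, by linarith [abs_nonneg ρ₀.im], fun ρ hρ hR ↦ ?_⟩
  have hβ0 := ZetaZeros.riemannZetaNontrivialZeros.re_pos hρ
  have hβ1 := ZetaZeros.riemannZetaNontrivialZeros.re_lt_one hρ
  have hβ0' := ZetaZeros.riemannZetaNontrivialZeros.re_pos hρ₀
  have hβ1' := ZetaZeros.riemannZetaNontrivialZeros.re_lt_one hρ₀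
  -- |γ - γ₀| ≥ G + |γ₀|
  have hre : |(ρ - ρ₀).re| ≤ 1 := by
    rw [sub_re, abs_le]; constructor <;> linarith
  have hγγ : G + |ρ₀.im| ≤ |ρ.im - ρ₀.im| := by
    have h1 := Complex.norm_le_abs_re_add_abs_im (ρ - ρ₀)
    rw [sub_im] at h1
    linarith
  have hγ : G ≤ |ρ.im| := by
    have := abs_sub ρ.im ρ₀.im
    linarith
  -- ‖ρ - 1/2‖ ≥ |γ| ≥ G
  have hn : G ≤ ‖ρ - 1 / 2‖ := by
    have h1 := Complex.abs_im_le_norm (ρ - 1 / 2)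
    have h2 : (ρ - 1 / 2).im = ρ.im := by simp
    rw [h2] at h1
    exact hγ.trans h1
  have hn0 : 0 < ‖ρ - 1 / 2‖ := lt_of_lt_of_le (by linarith) hn
  -- the decay estimate
  have hdec := norm_weilMellin_decay hh hβ0.le hβ1.le
  rw [← hC] at hdec
  set X := ‖ρ - 1 / 2‖ ^ 2 * ‖weilMellin h ρ‖ with hX
  have hX0 : 0 ≤ X := by positivity
  have hGsq : G ^ 2 ≤ 1 + ρ.im ^ 2 := by
    have : G ^ 2 ≤ |ρ.im| ^ 2 := pow_le_pow_left₀ hG0 hγ 2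
    rw [sq_abs] at this
    linarith
  -- X ≤ C / G², so 4 X ≤ 4C/G² ≤ ε (from ε G ≥ 4C and G ≥ 1)
  have h4X : 4 * X ≤ ε := by
    have h1 : G ^ 2 * X ≤ C := by
      calc G ^ 2 * X ≤ (1 + ρ.im ^ 2) * X := mul_le_mul_of_nonneg_right hGsq hX0
        _ ≤ C := hdec
    have h2 : 4 * C ≤ ε * G := by
      have := (div_le_iff₀ hε).1 hGC
      linarith
    have h3 : ε * G ≤ ε * G ^ 2 := by
      have : G ≤ G ^ 2 := by nlinarith
      exact mul_le_mul_of_nonneg_left this hε.le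
    nlinarith
  -- ‖ρ - ρ₀‖² ≤ 2‖ρ - 1/2‖² + 2A² ≤ 4 ‖ρ - 1/2‖²
  have hd : ‖ρ - ρ₀‖ ^ 2 ≤ 4 * ‖ρ - 1 / 2‖ ^ 2 := by
    have h1 : ‖ρ - ρ₀‖ ≤ ‖ρ - 1 / 2‖ + A := by
      rw [hA, show ρ - ρ₀ = (ρ - 1 / 2) - (ρ₀ - 1 / 2) by ring]
      exact norm_sub_le _ _
    have h2 : A ≤ ‖ρ - 1 / 2‖ := hGA.trans hn
    have h3 : 0 ≤ A := norm_nonneg _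
    nlinarith [norm_nonneg (ρ - ρ₀), norm_nonneg (ρ - 1 / 2)]
  have hd0 : 0 < ‖ρ - ρ₀‖ := lt_of_lt_of_le (by linarith [abs_nonneg ρ₀.im]) hR
  rw [le_div_iff₀ (by positivity)]
  calc ‖weilMellin h ρ‖ * ‖ρ - ρ₀‖ ^ 2 ≤ ‖weilMellin h ρ‖ * (4 * ‖ρ - 1 / 2‖ ^ 2) :=
        mul_le_mul_of_nonneg_left hd (norm_nonneg _)
    _ = 4 * X := by rw [hX]; ring
    _ ≤ ε := h4X

/-- RH-FREE theorem. **The approximation step of the printed proof of Prop. C.1, PROVED** —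
Yoshida's Lemma 1 ("Suppose that a non-trivial zero `ρ₀` … and any positive number `ε` are given.
Then there exists an `α ∈ C_c^∞(ℝ)` such that `M(α)(ρ₀) = 1`, `|M(α)(ρ)| ≤ ε/|ρ − ρ₀|²` for
every `ρ ≠ ρ₀`") refined as Connes–Consani prescribe: "given `ε > 0` and `ρ₀ ∈ Z`, there exists
`g₀ ∈ C_c^∞(ℝ₊*)` such that `g̃₀(z) = 0` for `z ∈ F`, `g̃₀(ρ₀) = 1`, `|g̃₀(ρ)| ≤ ε/|ρ − ρ₀|²` for
`ρ ∈ Z`, `ρ ≠ ρ₀`. In order to fulfill the additional vanishing condition … one adjoins `F` to the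
finite set of zeros fulfilling `|ρ − ρ₀| < R` … and one then proceeds exactly as in [Yoshida]."
Typed in the additive avatar (`g̃ ↦ weilMellin`, `C_c^∞(ℝ₊*) ↦ IsWeilTest`), under Prop. C.1's
standing hypotheses `F` finite, `F ∩ Z = ∅` (so `ρ₀ ∉ F`). Proof = the printed one: `α₀ = b/b̂(ρ₀)`
for a bump `b` with `Re b̂ > 0` on the line through `ρ₀` (`exists_isWeilTest_re_weilMellin_pos`);
`R` from `exists_radius_norm_weilMellin_le` (applied with `ε' = min(ε, 1/2) < 1`, "we may assume
`ε < 1`"); `β` = the Mellin killer (`mellinKillList`, in place of Yoshida's convolution factors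
`αᵢ`) of the finite set `F ∪ (Z ∩ B(ρ₀, R) ∖ {ρ₀})` applied to `b` and normalised at `ρ₀`, with
strip bound `C_β = weilL1 β` (`norm_weilMellin_le_weilL1`); `N` with `C_β ε'^N ≤ 1`; and
`g₀ = α₀^{⋆(N+1)} ⋆ β`, so `g̃₀ = α̂₀^{N+1} β̂` vanishes on `F`, equals `1` at `ρ₀`, vanishes at the
zeros within `R`, and at a zero with `‖ρ − ρ₀‖ ≥ R ≥ 1` is at most
`(ε'/‖ρ − ρ₀‖²)^{N+1} C_β ≤ ε'/‖ρ − ρ₀‖² ≤ ε/‖ρ − ρ₀‖²`. Not used by the tree's proof of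
Prop. C.1 above (which detects zeros by `pairCoeff` instead); recorded because it is the one new
mathematical step App. C prints.
[cite: ConnesConsani2021, App. C, proof of Prop. C.1 (= arXiv:2006.13771v1 running item 46; PDF p. 51; chunk p0032:L10–L15); Yoshida1992HermitianForms Lemma 1 p. 285] -/
theorem exists_mellinVanishOn_approx {F : Set ℂ} (hF : F.Finite)
    (hFZ : Disjoint F ZetaZeros.riemannZetaNontrivialZeros) {ε : ℝ} (hε : 0 < ε) {ρ₀ : ℂ}
    (hρ₀ : ρ₀ ∈ ZetaZeros.riemannZetaNontrivialZeros) :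
    ∃ g : ℝ → ℂ, IsWeilTest g ∧ MellinVanishOn F g ∧ weilMellin g ρ₀ = 1 ∧
      ∀ ρ ∈ ZetaZeros.riemannZetaNontrivialZeros, ρ ≠ ρ₀ →
        ‖weilMellin g ρ‖ ≤ ε / ‖ρ - ρ₀‖ ^ 2 := by
  -- Step 0: "We may assume ε < 1".
  set ε' : ℝ := min ε (1 / 2) with hε'
  have hε'0 : 0 < ε' := lt_min hε (by norm_num)
  have hε'1 : ε' < 1 := (min_le_right _ _).trans_lt (by norm_num)
  have hε'ε : ε' ≤ ε := min_le_left _ _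
  -- Step 1: a bump `b` with `b̂ ≠ 0` on the horizontal line through `ρ₀`, and `α₀ = b / b̂(ρ₀)`.
  obtain ⟨b, hb, hbpos⟩ := exists_isWeilTest_re_weilMellin_pos ρ₀.im
  have hbρ₀ : weilMellin b ρ₀ ≠ 0 := by
    intro h0
    have := hbpos ρ₀.re
    rw [show (ρ₀.re : ℂ) + ρ₀.im * I = ρ₀ from Complex.re_add_im ρ₀, h0, Complex.zero_re] at this
    exact lt_irrefl _ this
  set α₀ : ℝ → ℂ := fun t ↦ (weilMellin b ρ₀)⁻¹ * b t with hα₀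
  have hα₀t : IsWeilTest α₀ := hb.const_mul _
  have hα₀M : ∀ s, weilMellin α₀ s = (weilMellin b ρ₀)⁻¹ * weilMellin b s := fun s ↦
    weilMellin_const_mul _ _ _
  have hα₀1 : weilMellin α₀ ρ₀ = 1 := by rw [hα₀M, inv_mul_cancel₀ hbρ₀]
  -- Step 2: the radius `R` beyond which `‖α̂₀(ρ)‖ ≤ ε'/‖ρ - ρ₀‖²`.
  obtain ⟨R, hR1, hR⟩ := exists_radius_norm_weilMellin_le hα₀t hε'0 hρ₀
  -- Step 3: the finite set `F' = F ∪ (zeros within `R` of `ρ₀`, other than `ρ₀`)` and the killed,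
  -- normalised bump `β` with `β̂|_{F'} = 0`, `β̂(ρ₀) = 1`.
  set F' : Set ℂ := F ∪ ((ZetaZeros.riemannZetaNontrivialZeros ∩ Metric.ball ρ₀ R) \ {ρ₀})
    with hF'
  have hF'fin : F'.Finite :=
    hF.union ((riemannZetaNontrivialZeros_finite_inter_ball ρ₀ R).subset fun _ hz ↦ hz.1)
  have hρ₀F' : ρ₀ ∉ F' := by
    rintro (h | h)
    · exact Set.disjoint_left.1 hFZ h hρ₀
    · exact h.2 rfl
  set l : List ℂ := hF'fin.toFinset.toList with hl
  have hmem : ∀ z : ℂ, z ∈ l ↔ z ∈ F' := fun z ↦ by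
    rw [hl, Finset.mem_toList, Set.Finite.mem_toFinset]
  set β₁ : ℝ → ℂ := mellinKillList l b with hβ₁
  have hβ₁t : IsWeilTest β₁ := isWeilTest_mellinKillList l hb
  have hβ₁M : ∀ s, weilMellin β₁ s = (l.map (· - s)).prod * weilMellin b s := fun s ↦
    weilMellin_mellinKillList l hb s
  have hβ₁ρ₀ : weilMellin β₁ ρ₀ ≠ 0 := by
    rw [hβ₁M]
    exact mul_ne_zero (prod_map_sub_ne_zero fun h ↦ hρ₀F' ((hmem _).1 h)) hbρ₀
  set β : ℝ → ℂ := fun t ↦ (weilMellin β₁ ρ₀)⁻¹ * β₁ t with hβ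
  have hβt : IsWeilTest β := hβ₁t.const_mul _
  have hβM : ∀ s, weilMellin β s = (weilMellin β₁ ρ₀)⁻¹ * weilMellin β₁ s := fun s ↦
    weilMellin_const_mul _ _ _
  have hβ1 : weilMellin β ρ₀ = 1 := by rw [hβM, inv_mul_cancel₀ hβ₁ρ₀]
  have hβF' : ∀ z ∈ F', weilMellin β z = 0 := fun z hz ↦ by
    rw [hβM, mellinVanishOn_mellinKillList l hb z ((hmem z).2 hz), mul_zero]
  -- Step 4: the strip bound `C_β` of `β̂` and the exponent `N` with `C_β ε'^N ≤ 1`.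
  set Cβ : ℝ := weilL1 β with hCβ
  have hCβ0 : 0 ≤ Cβ := weilL1_nonneg _
  have hβle : ∀ ρ ∈ ZetaZeros.riemannZetaNontrivialZeros, ‖weilMellin β ρ‖ ≤ Cβ := fun ρ hρ ↦
    norm_weilMellin_le_weilL1 hβt.1.continuous hβt.2
      (ZetaZeros.riemannZetaNontrivialZeros.re_pos hρ).le
      (ZetaZeros.riemannZetaNontrivialZeros.re_lt_one hρ).le
  obtain ⟨N, hN⟩ : ∃ N : ℕ, Cβ * ε' ^ N ≤ 1 := by
    obtain ⟨N, hN⟩ := exists_pow_lt_of_lt_one (x := 1 / (Cβ + 1)) (by positivity) hε'1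
    refine ⟨N, ?_⟩
    have h1 : Cβ * ε' ^ N ≤ Cβ * (1 / (Cβ + 1)) :=
      mul_le_mul_of_nonneg_left hN.le hCβ0
    have h2 : Cβ * (1 / (Cβ + 1)) ≤ 1 := by
      rw [mul_one_div, div_le_one (by positivity)]
      linarith
    exact h1.trans h2
  -- Step 5: `α = α₀^{⋆(N+1)} ⋆ β`.
  have hPt : IsWeilTest (weilConvPow α₀ N) := isWeilTest_weilConvPow hα₀t N
  refine ⟨weilConv (weilConvPow α₀ N) β, hPt.weilConv hβt, ?_, ?_, ?_⟩
  · -- vanishing on `F ⊆ F'`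
    intro z hz
    rw [weilMellin_weilConv_holds hPt.1.continuous hPt.2 hβt.1.continuous hβt.2,
      hβF' z (Or.inl hz), mul_zero]
  · -- value `1` at `ρ₀`
    rw [weilMellin_weilConv_holds hPt.1.continuous hPt.2 hβt.1.continuous hβt.2,
      weilMellin_weilConvPow hα₀t, hα₀1, hβ1, one_pow, one_mul]
  · -- decay at the other zeros
    intro ρ hρ hne
    have hd0 : 0 ≤ ε / ‖ρ - ρ₀‖ ^ 2 := by positivity
    rw [weilMellin_weilConv_holds hPt.1.continuous hPt.2 hβt.1.continuous hβt.2,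
      weilMellin_weilConvPow hα₀t]
    by_cases hlt : ‖ρ - ρ₀‖ < R
    · -- a nearby zero: killed exactly
      have hρF' : ρ ∈ F' :=
        Or.inr ⟨⟨hρ, by rwa [Metric.mem_ball, dist_eq_norm]⟩, fun h ↦ hne h⟩
      rw [hβF' ρ hρF', mul_zero, norm_zero]
      exact hd0
    · -- a far zero: `(ε'/d²)^{N+1} C_β ≤ ε'/d² ≤ ε/d²`
      have hlt : R ≤ ‖ρ - ρ₀‖ := le_of_not_gt hlt
      have hq := hR ρ hρ hlt
      set d := ‖ρ - ρ₀‖ with hd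
      have hd1 : 1 ≤ d := hR1.trans hlt
      have hq0 : 0 ≤ ε' / d ^ 2 := by positivity
      have hq1 : ε' / d ^ 2 ≤ ε' := by
        rw [div_le_iff₀ (by positivity)]
        have : ε' * 1 ≤ ε' * d ^ 2 := mul_le_mul_of_nonneg_left (by nlinarith) hε'0.le
        linarith
      rw [norm_mul, norm_pow]
      calc ‖weilMellin α₀ ρ‖ ^ (N + 1) * ‖weilMellin β ρ‖
          ≤ (ε' / d ^ 2) ^ (N + 1) * Cβ :=
            mul_le_mul (pow_le_pow_left₀ (norm_nonneg _) hq _) (hβle ρ hρ) (norm_nonneg _)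
              (by positivity)
        _ = ε' / d ^ 2 * (Cβ * (ε' / d ^ 2) ^ N) := by ring
        _ ≤ ε' / d ^ 2 * (Cβ * ε' ^ N) :=
            mul_le_mul_of_nonneg_left
              (mul_le_mul_of_nonneg_left (pow_le_pow_left₀ hq0 hq1 N) hCβ0) hq0
        _ ≤ ε' / d ^ 2 * 1 := mul_le_mul_of_nonneg_left hN hq0
        _ ≤ ε / d ^ 2 := by
            rw [mul_one]
            exact div_le_div_of_nonneg_right hε'ε (by positivity)

end Literature.NumberTheory.ConnesConsani2021

end
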